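import Summits.AtomisticToContinuum.Crystallization.Theorems.MinimiserShells.Negative.LoadBearing
import Summits.AtomisticToContinuum.Crystallization.Theorems.MinimiserShells.Negative.HiddenDependency

/-!
# Negative knowledge for crux `MinimiserShells` (stmt-AtomisticToContinuum-9225) — uniformly rooted
# finite configurations (EXACT finite mass transport) and the failure of every SLACK version

`unifRooted x = (1/N) Σ_i δ_{count|(x − x_i)}`, the configuration `x` seen from a uniformly chosen
particle, is point-stationary EXACTLY (`isPointStationaryLaw_unifRooted`: the finite double count
`Σ_i Σ_k g(θ_{x_i}x, x_k − x_i) = Σ_k Σ_i g(θ_{x_k}x, x_i − x_k)`), almost surely hard-core at the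
configuration's own separation (`ae_isRootedHardCore_unifRooted`) and has mean root energy
`E_{P_x}[h] = 𝓔_N(x)/N` EXACTLY (`meanRootEnergy_unifRooted`).  Consequences for the crux:

* `exists_bad_mix` — a point-stationary hard-core probability law with `E_P[h] < θ`, mixed with the
  lone root, is a point-stationary hard-core probability law with `E_P[h] ≤ θ` whose root shell is
  empty with positive probability;
* `MinimiserShellsSlack s` (the crux with `E_P[h] ≤ e*` relaxed to `≤ e* + s`; slack `0` IS the crux,
  `minimiserShellsSlack_zero_iff`) is refuted for `s ≥ −e*` by the lone root
  (`not_minimiserShellsSlack_of_neg_eStar_le`), by any cheap law of energy `< e* + s`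
  (`not_minimiserShellsSlack_of_law`), hence for EVERY `s > 0` modulo the soft support item 0626
  `CrysEnergyLimit` (`not_minimiserShellsSlack_of_crysEnergyLimit`: uniformly rooted Lennard-Jones
  ground states, `exists_isGroundState_separated` + `E(N)/N → e*`).

So no argument stable under `E_P[h] ↦ E_P[h] + s` proves the crux: exact minimality must enter
through a first-order mechanism `E_P[h] ≥ e* + c·P(bad root shell)`, and by
`LoadBearing.not_pointwiseMinimiserShells` the constant cannot come from a pointwise certificate.
Standing disprover gen 1; supports item stmt-AtomisticToContinuum-9225; workfile
`Cruxes/MinimiserShells/Disproof.lean` §3–§4.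
-/

noncomputable section

open MeasureTheory
open scoped ENNReal BigOperators

namespace Summit.AtomisticToContinuum.Crystallization.Theorems.MinimiserShells.Negative.UniformRooting

open Literature.Probability.Process
open Literature.MathematicalPhysics.StatisticalMechanics
open Literature.Geometry.DiscreteGeometry
open Summit.AtomisticToContinuum.Crystallization.Theses.PalmUnimodularRigidity
  (MinimiserShells CrysEnergyLimit)
open Summit.AtomisticToContinuum.Crystallization.Theorems.MinimiserShells.Negative.LoadBearing
  (eStar meanRootEnergy GoodShell minimiserShells_iff not_goodShell_dirac_zero
    ae_eq_dirac_count_restrict meanRootEnergy_dirac_count_restrict)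
open Summit.AtomisticToContinuum.Crystallization.Theorems.MinimiserShells.Negative.HiddenDependency
  (exists_mixing_weight meanRootEnergy_mix_le)

/-- **The bad minimising mixture.** A point-stationary `δ`-hard-core probability law with mean root
energy `< θ`, mixed with the lone root, gives a point-stationary `δ`-hard-core probability law with
mean root energy `≤ θ` whose root shell is NOT almost surely good (it is empty with positive
probability). With `θ = e*` this gives `HiddenDependency`; with `θ = e* + s` it kills every slack
version.
[folklore] -/
theorem exists_bad_mix {θ δ : ℝ} (P : Measure (Measure (EuclideanSpace ℝ (Fin 3)))) [IsProbabilityMeasure P]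
    (hcore : ∀ᵐ μ ∂P, IsRootedHardCore δ μ) (hstat : IsPointStationaryLaw P)
    (hlt : meanRootEnergy P < θ) :
    ∃ P' : Measure (Measure (EuclideanSpace ℝ (Fin 3))), IsProbabilityMeasure P' ∧ (∀ᵐ μ ∂P', IsRootedHardCore δ μ) ∧
      IsPointStationaryLaw P' ∧ meanRootEnergy P' ≤ θ ∧ ¬ (∀ᵐ μ ∂P', GoodShell μ) := by
  obtain ⟨τ, hτ0, hτ1, hτE⟩ := exists_mixing_weight hlt
  set t : ℝ≥0∞ := ENNReal.ofReal τ with ht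
  set Q : Measure (Measure (EuclideanSpace ℝ (Fin 3))) := Measure.dirac (Measure.dirac (0 : (EuclideanSpace ℝ (Fin 3)))) with hQ
  have haeQ := ae_dirac_dirac_zero (G := (EuclideanSpace ℝ (Fin 3))) (measurableSet_singleton 0)
  have ht0 : t ≠ 0 := by simpa [ht, ENNReal.ofReal_eq_zero, not_le] using hτ0
  have ht1 : t ≤ 1 := ENNReal.ofReal_le_one.2 hτ1.le
  haveI hP' : IsProbabilityMeasure ((1 - t) • P + t • Q) := by
    constructor
    simp only [Measure.add_apply, Measure.smul_apply, smul_eq_mul, measure_univ, mul_one]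
    exact tsub_add_cancel_of_le ht1
  refine ⟨(1 - t) • P + t • Q, hP', ?_, ?_, meanRootEnergy_mix_le hτ0 hτ1 hlt hτE, fun hgood => ?_⟩
  · exact ae_add_measure_iff.2 ⟨Measure.ae_smul_measure hcore _,
      Measure.ae_smul_measure (haeQ.mono fun μ hμ => by rw [hμ]; exact isRootedHardCore_dirac_zero δ) _⟩
  · exact (hstat.smul _).add (isPointStationaryLaw_dirac_dirac_zero.smul _)
  · have hgoodQ : ∀ᵐ μ ∂Q, GoodShell μ :=
      (Measure.ae_ennreal_smul_measure_iff ht0).1 (ae_add_measure_iff.1 hgood).2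
    obtain ⟨μ, hμg, hμe⟩ := (hgoodQ.and haeQ).exists
    rw [hμe] at hμg
    exact not_goodShell_dirac_zero hμg

section UnifRooted

variable {N : ℕ}

/-- The configuration `x` seen from particle `i`: the finite set `{x_k − x_i | k}`. -/
def rootedAt (x : Fin N → (EuclideanSpace ℝ (Fin 3))) (i : Fin N) : Finset (EuclideanSpace ℝ (Fin 3)) := Finset.univ.image fun k => x k - x i

/-- Its counting measure `count|{x_k − x_i | k}`. -/
def rootedMeasure (x : Fin N → (EuclideanSpace ℝ (Fin 3))) (i : Fin N) : Measure (EuclideanSpace ℝ (Fin 3)) :=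
  (Measure.count : Measure (EuclideanSpace ℝ (Fin 3))).restrict (↑(rootedAt x i) : Set (EuclideanSpace ℝ (Fin 3)))

/-- `rootedMeasure` in the `Set.range` form of `RootEnergy.lean`. [folklore] -/
theorem rootedMeasure_eq_range (x : Fin N → (EuclideanSpace ℝ (Fin 3))) (i : Fin N) :
    rootedMeasure x i = (Measure.count : Measure (EuclideanSpace ℝ (Fin 3))).restrict (Set.range fun k => x k - x i) := by
  rw [rootedMeasure, rootedAt, range_sub_eq_coe_image]

/-- **The uniformly rooted empirical law** `P_x = (1/N) Σ_i δ_{count|(x − x_i)}`. -/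
def unifRooted (x : Fin N → (EuclideanSpace ℝ (Fin 3))) : Measure (Measure (EuclideanSpace ℝ (Fin 3))) :=
  ((N : ℝ≥0∞)⁻¹) • ∑ i : Fin N, (Measure.dirac (rootedMeasure x i) : Measure (Measure (EuclideanSpace ℝ (Fin 3))))

/-- `P_x` is a probability law (`N ≠ 0`). [folklore] -/
theorem isProbabilityMeasure_unifRooted [NeZero N] (x : Fin N → (EuclideanSpace ℝ (Fin 3))) :
    IsProbabilityMeasure (unifRooted x) := by
  constructor
  simp only [unifRooted, Measure.smul_apply, Measure.coe_finsetSum, Finset.sum_apply,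
    measure_univ, Finset.sum_const, Finset.card_univ, Fintype.card_fin, smul_eq_mul,
    nsmul_eq_mul, mul_one]
  exact ENNReal.inv_mul_cancel (by exact_mod_cast (NeZero.ne N)) (ENNReal.natCast_ne_top N)

/-- Under `δ_{count|(x − x_i)}` a.e. configuration is `count|(x − x_i)`. [folklore] -/
theorem ae_eq_dirac_rootedMeasure (x : Fin N → (EuclideanSpace ℝ (Fin 3))) (i : Fin N) :
    ∀ᵐ μ ∂(Measure.dirac (rootedMeasure x i) : Measure (Measure (EuclideanSpace ℝ (Fin 3)))), μ = rootedMeasure x i := by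
  unfold rootedMeasure
  exact ae_eq_dirac_count_restrict _

/-- `∫⁻` against `δ_{count|(x − x_i)}` evaluates (no measurability needed). [folklore] -/
theorem lintegral_dirac_rootedMeasure (x : Fin N → (EuclideanSpace ℝ (Fin 3))) (i : Fin N) (G : Measure (EuclideanSpace ℝ (Fin 3)) → ℝ≥0∞) :
    ∫⁻ μ, G μ ∂(Measure.dirac (rootedMeasure x i) : Measure (Measure (EuclideanSpace ℝ (Fin 3)))) =
      G (rootedMeasure x i) := by
  have heq : (fun μ => G μ) =ᵐ[(Measure.dirac (rootedMeasure x i) : Measure (Measure (EuclideanSpace ℝ (Fin 3))))]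
      fun _ => G (rootedMeasure x i) :=
    (ae_eq_dirac_rootedMeasure x i).mono fun μ hμ => by simp only [hμ]
  rw [lintegral_congr_ae heq, lintegral_const, measure_univ, mul_one]

/-- `∫` against `δ_{count|(x − x_i)}` evaluates (no measurability needed). [folklore] -/
theorem integral_dirac_rootedMeasure (x : Fin N → (EuclideanSpace ℝ (Fin 3))) (i : Fin N) (G : Measure (EuclideanSpace ℝ (Fin 3)) → ℝ) :
    ∫ μ, G μ ∂(Measure.dirac (rootedMeasure x i) : Measure (Measure (EuclideanSpace ℝ (Fin 3)))) =
      G (rootedMeasure x i) := by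
  have heq : (fun μ => G μ) =ᵐ[(Measure.dirac (rootedMeasure x i) : Measure (Measure (EuclideanSpace ℝ (Fin 3))))]
      fun _ => G (rootedMeasure x i) :=
    (ae_eq_dirac_rootedMeasure x i).mono fun μ hμ => by simp only [hμ]
  rw [integral_congr_ae heq]
  simp

/-- Every real functional is integrable against `δ_{count|(x − x_i)}` (it is a.e. constant).
[folklore] -/
theorem integrable_dirac_rootedMeasure (x : Fin N → (EuclideanSpace ℝ (Fin 3))) (i : Fin N) (G : Measure (EuclideanSpace ℝ (Fin 3)) → ℝ) :
    Integrable G (Measure.dirac (rootedMeasure x i) : Measure (Measure (EuclideanSpace ℝ (Fin 3)))) :=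
  (integrable_const (G (rootedMeasure x i))).congr
    ((ae_eq_dirac_rootedMeasure x i).mono fun μ hμ => by simp only [hμ])

/-- Expectation under the uniformly rooted law: `E_{P_x}[G] = (1/N) Σ_i G(count|(x − x_i))`
(`ℝ≥0∞`-valued). [folklore] -/
theorem lintegral_unifRooted (x : Fin N → (EuclideanSpace ℝ (Fin 3))) (G : Measure (EuclideanSpace ℝ (Fin 3)) → ℝ≥0∞) :
    ∫⁻ μ, G μ ∂(unifRooted x) = (N : ℝ≥0∞)⁻¹ * ∑ i, G (rootedMeasure x i) := by
  rw [unifRooted, lintegral_smul_measure, lintegral_finsetSum_measure]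
  simp_rw [lintegral_dirac_rootedMeasure]
  rfl

/-- Expectation under the uniformly rooted law (real-valued). [folklore] -/
theorem integral_unifRooted (x : Fin N → (EuclideanSpace ℝ (Fin 3))) (G : Measure (EuclideanSpace ℝ (Fin 3)) → ℝ) :
    ∫ μ, G μ ∂(unifRooted x) = (N : ℝ)⁻¹ * ∑ i, G (rootedMeasure x i) := by
  rw [unifRooted, integral_smul_measure,
    integral_finsetSum_measure fun i _ => integrable_dirac_rootedMeasure x i G]
  simp_rw [integral_dirac_rootedMeasure]
  rw [smul_eq_mul, ENNReal.toReal_inv, ENNReal.toReal_natCast]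

/-- Sums over the rooted configuration: `∫⁻ f d(count|(x − x_i)) = Σ_k f(x_k − x_i)` for distinct
points. [folklore] -/
theorem lintegral_rootedMeasure {x : Fin N → (EuclideanSpace ℝ (Fin 3))} (hx : Function.Injective x) (i : Fin N)
    (f : (EuclideanSpace ℝ (Fin 3)) → ℝ≥0∞) : ∫⁻ y, f y ∂(rootedMeasure x i) = ∑ k, f (x k - x i) := by
  have hinj : Function.Injective fun k => x k - x i := fun k l h => hx (sub_left_inj.1 h)
  rw [rootedMeasure, count_restrict_coe_finset, lintegral_finsetSum_measure]
  simp_rw [lintegral_dirac]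
  rw [rootedAt, Finset.sum_image fun k _ l _ h => hinj h]

/-- **Re-rooting**: shifting `count|(x − x_i)` by the point `x_k − x_i` gives `count|(x − x_k)`.
[folklore] -/
theorem map_sub_rootedMeasure (x : Fin N → (EuclideanSpace ℝ (Fin 3))) (i k : Fin N) :
    (rootedMeasure x i).map (fun z => z - (x k - x i)) = rootedMeasure x k := by
  rw [rootedMeasure, rootedMeasure, map_sub_count_restrict]
  congr 1
  rw [rootedAt, rootedAt, Finset.coe_image, Finset.coe_image, Set.image_image]
  refine Set.image_congr fun l _ => ?_
  abel

/-- **Exact finite mass transport**: the uniformly rooted law of a configuration of distinct points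
is point-stationary (`Σ_i Σ_k g(θ_{x_i} x, x_k − x_i) = Σ_k Σ_i g(θ_{x_k} x, x_i − x_k)`).
[folklore] -/
theorem isPointStationaryLaw_unifRooted {x : Fin N → (EuclideanSpace ℝ (Fin 3))} (hx : Function.Injective x) :
    IsPointStationaryLaw (unifRooted x) := by
  intro g _
  rw [lintegral_unifRooted, lintegral_unifRooted]
  congr 1
  simp_rw [lintegral_rootedMeasure hx, map_sub_rootedMeasure, neg_sub]
  exact Finset.sum_comm

/-- The rooted configuration of a `δ`-separated configuration is a rooted `δ`-hard-core
configuration. [folklore] -/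
theorem isRootedHardCore_rootedMeasure {x : Fin N → (EuclideanSpace ℝ (Fin 3))} {δ : ℝ}
    (hsep : ∀ k l, k ≠ l → δ ≤ dist (x k) (x l)) (i : Fin N) :
    IsRootedHardCore δ (rootedMeasure x i) := by
  refine ⟨↑(rootedAt x i), ?_, ?_, rfl⟩
  · exact Finset.mem_coe.2 (Finset.mem_image.2 ⟨i, Finset.mem_univ _, sub_self _⟩)
  · intro y hy y' hy' hne
    rw [Finset.mem_coe, rootedAt, Finset.mem_image] at hy hy'
    obtain ⟨k, -, rfl⟩ := hy
    obtain ⟨l, -, rfl⟩ := hy'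
    rw [dist_sub_right]
    exact hsep k l fun h => hne (by rw [h])

/-- Hence the uniformly rooted law is a.s. `δ`-hard-core. [folklore] -/
theorem ae_isRootedHardCore_unifRooted {x : Fin N → (EuclideanSpace ℝ (Fin 3))} {δ : ℝ}
    (hsep : ∀ k l, k ≠ l → δ ≤ dist (x k) (x l)) :
    ∀ᵐ μ ∂(unifRooted x), IsRootedHardCore δ μ := by
  unfold unifRooted
  refine Measure.ae_smul_measure ?_ _
  rw [ae_iff]
  simp only [Measure.coe_finsetSum, Finset.sum_apply, Finset.sum_eq_zero_iff, Finset.mem_univ,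
    true_imp_iff]
  intro i
  exact ae_iff.1 ((ae_eq_dirac_rootedMeasure x i).mono fun μ hμ => by
    rw [hμ]; exact isRootedHardCore_rootedMeasure hsep i)

/-- **Energy identity**: `E_{P_x}[h] = 𝓔_N(x)/N` exactly (Lennard-Jones, distinct points).
[folklore] -/
theorem meanRootEnergy_unifRooted {x : Fin N → (EuclideanSpace ℝ (Fin 3))} (hx : Function.Injective x) :
    meanRootEnergy (unifRooted x) = interactionEnergy lennardJones x / N := by
  unfold meanRootEnergy
  rw [integral_unifRooted]
  have h : ∀ i, (∫ y, lennardJones ‖y‖ ∂(rootedMeasure x i)) / 2 =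
      rootEnergy lennardJones ((Measure.count : Measure (EuclideanSpace ℝ (Fin 3))).restrict
        (Set.range fun k => x k - x i)) := fun i => by
    rw [← rootedMeasure_eq_range]; rfl
  simp_rw [h, sum_rootEnergy_rooted_lennardJones hx]
  rw [div_eq_inv_mul]

end UnifRooted

/-- The `s`-SLACK version of the crux: laws with `E_P[h] ≤ e* + s` have good root shells a.s. -/
def MinimiserShellsSlack (s : ℝ) : Prop :=
  ∀ δ : ℝ, 0 < δ → ∀ P : Measure (Measure (EuclideanSpace ℝ (Fin 3))), IsProbabilityMeasure P →
    (∀ᵐ μ ∂P, IsRootedHardCore δ μ) → IsPointStationaryLaw P → meanRootEnergy P ≤ eStar + s →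
    ∀ᵐ μ ∂P, GoodShell μ

/-- Slack `0` is the crux. [folklore] -/
theorem minimiserShellsSlack_zero_iff : MinimiserShellsSlack 0 ↔ MinimiserShells := by
  rw [minimiserShells_iff]
  simp only [MinimiserShellsSlack, add_zero]

/-- The slack versions are monotone. [folklore] -/
theorem MinimiserShellsSlack.anti {s s' : ℝ} (h : s ≤ s') (H : MinimiserShellsSlack s') :
    MinimiserShellsSlack s := fun δ hδ P hP hcore hstat hE =>
  H δ hδ P hP hcore hstat (hE.trans (by linarith))

/-- Slack `≥ −e*` is refuted by the lone root alone (energy `0`). [folklore] -/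
theorem not_minimiserShellsSlack_of_neg_eStar_le {s : ℝ} (hs : -eStar ≤ s) :
    ¬ MinimiserShellsSlack s := by
  intro h
  have hae := ae_dirac_dirac_zero (G := (EuclideanSpace ℝ (Fin 3))) (measurableSet_singleton 0)
  have hgood := h 1 one_pos (Measure.dirac (Measure.dirac (0 : (EuclideanSpace ℝ (Fin 3))))) inferInstance
    (hae.mono fun μ hμ => by rw [hμ]; exact isRootedHardCore_dirac_zero 1)
    isPointStationaryLaw_dirac_dirac_zero (by
      have h0 : meanRootEnergy (Measure.dirac (Measure.dirac (0 : EuclideanSpace ℝ (Fin 3)))) = 0 := by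
        unfold meanRootEnergy
        rw [HiddenDependency.integral_dirac_dirac_zero]
        simp [lennardJones_zero]
      rw [h0]; linarith)
  obtain ⟨μ, hμg, hμe⟩ := (hgood.and hae).exists
  rw [hμe] at hμg
  exact not_goodShell_dirac_zero hμg

/-- **One cheap law kills a slack version**: a point-stationary hard-core probability law with
`E_P[h] < e* + s` refutes `MinimiserShellsSlack s` (mix with the lone root). [folklore] -/
theorem not_minimiserShellsSlack_of_law {s δ : ℝ} (hδ : 0 < δ) (P : Measure (Measure (EuclideanSpace ℝ (Fin 3))))
    [IsProbabilityMeasure P] (hcore : ∀ᵐ μ ∂P, IsRootedHardCore δ μ)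
    (hstat : IsPointStationaryLaw P) (hE : meanRootEnergy P < eStar + s) :
    ¬ MinimiserShellsSlack s := by
  intro h
  obtain ⟨P', hP', hcore', hstat', hE', hbad⟩ := exists_bad_mix P hcore hstat hE
  exact hbad (h δ hδ P' hP' hcore' hstat' hE')

/-- **No slack version of the crux holds** (modulo the soft support item 0626 `CrysEnergyLimit`,
`E(N)/N → e*`): for every `s > 0`, uniformly rooted Lennard-Jones ground states with `N` large are
point-stationary hard-core laws of energy `E(N)/N < e* + s`. [folklore] -/
theorem not_minimiserShellsSlack_of_crysEnergyLimit
    (hlim : CrysEnergyLimit)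
    {s : ℝ} (hs : 0 < s) : ¬ MinimiserShellsSlack s := by
  obtain ⟨δ, hδ, hgs⟩ := exists_isGroundState_separated LennardJonesGroundStatesExist_holds
    LennardJonesMinimalDistance_holds
  have hlt : (⨅ Q : PeriodicConfiguration 3, Q.energyPerParticle lennardJones) < eStar + s := by
    change eStar < eStar + s
    linarith
  have hev : ∀ᶠ N : ℕ in Filter.atTop, groundStateEnergy lennardJones 3 N / N < eStar + s :=
    hlim.eventually (Iio_mem_nhds hlt)
  obtain ⟨N, hN, hN1⟩ := (hev.and (Filter.eventually_ge_atTop 1)).exists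
  haveI : NeZero N := ⟨by omega⟩
  obtain ⟨x, hxgs, hsep⟩ := hgs N
  haveI := isProbabilityMeasure_unifRooted x
  refine not_minimiserShellsSlack_of_law hδ (unifRooted x) (ae_isRootedHardCore_unifRooted hsep)
    (isPointStationaryLaw_unifRooted hxgs.1) ?_
  rw [meanRootEnergy_unifRooted hxgs.1, hxgs.2]
  exact hN

end Summit.AtomisticToContinuum.Crystallization.Theorems.MinimiserShells.Negative.UniformRooting
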